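import Summits.RiemannHypothesis.RiemannHypothesis.Theorems.WeilBochnerMeasureCounting
import Literature.NumberTheory.LFunctions.RiemannSiegelStirling
import HarnessLib

/-!
# RiemannHypothesis — counting law of the Bochner–Kreĭn measure: Stirling form and local density

Helper file (`--supports stmt-RiemannHypothesis-0098`), RH-free, standard axioms.  Seat rh-explicit
weil-3 (structure).  Corollaries of `WeilBochnerMeasureCounting.lean` for a measure `μ` representing
Weil's form on a window `[-b, b]`, `b > 0`:

* `isBigO_measureReal_Icc_sub_main`: **`μ[0, T] = (T/2π) log(T/2π) − T/2π + O(log T)`** as `T → ∞`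
  (the counting law `μ[0, T] = θ(T)/π + O(log T)` combined with Stirling's formula for `θ`,
  `isBigO_riemannSiegelTheta_sub_stirling_holds`); this is the Riemann–von Mangoldt main term of
  `N(T)`, which `μ[0, T]` equals under RH;
* `theta_sub_theta_le`: `θ(T + 1) − θ(T) ≤ (5 + log(2 + T))/2` (`θ' = Re ψ(¼ + iu/2)/2 − (log π)/2`);
* `measureReal_Ioc_unit_le`: the **local density law `μ(T, T + 1] ≤ C (1 + log(2 + T))`** for `T ≥ 0`
  — every representing measure has at most logarithmic mass in unit intervals, the measure analogue of
  the local Weyl law `N(T + 1) − N(T) = O(log T)`.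
-/

noncomputable section

set_option linter.dupNamespace false  -- the mandated namespace repeats `RiemannHypothesis`

open Complex Filter Set MeasureTheory Asymptotics
open scoped Real Topology
open Literature.NumberTheory.LFunctions Literature.Analysis.SpecialFunctions

namespace Summit.RiemannHypothesis.RiemannHypothesis.Theorems.WeilBochnerMeasure

variable {b : ℝ} {μ : Measure ℝ}

/-! ## Stirling form of the counting law -/

/-- `log(1 + T) ≤ 2 log T` and `1 ≤ log T` for `T ≥ 3`. -/
theorem log_one_add_le_two_mul_log {T : ℝ} (hT : 3 ≤ T) :
    Real.log (1 + T) ≤ 2 * Real.log T ∧ 1 ≤ Real.log T := by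
  constructor
  · have h : Real.log (1 + T) ≤ Real.log (T ^ 2) := Real.log_le_log (by linarith) (by nlinarith)
    rwa [Real.log_pow, Nat.cast_ofNat] at h
  · rw [← Real.log_exp 1]
    exact Real.log_le_log (Real.exp_pos 1) (by have := Real.exp_one_lt_d9; linarith)

/-- **`μ[0, T] = (T/2π) log(T/2π) − T/2π + O(log T)`** for every measure representing Weil's form on a
window: the Riemann–von Mangoldt main term. -/
theorem isBigO_measureReal_Icc_sub_main (hb : 0 < b)
    (hμ : ∀ g : ℝ → ℂ, IsWeilTest g → tsupport g ⊆ Icc (-b) b →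
      Integrable (fun t : ℝ ↦ ‖weilMellin g (1 / 2 + t * I)‖ ^ 2) μ ∧
        weilQuadratic g = ((∫ t, ‖weilMellin g (1 / 2 + t * I)‖ ^ 2 ∂μ : ℝ) : ℂ)) :
    (fun T : ℝ ↦ μ.real (Icc 0 T) - (T / (2 * π) * Real.log (T / (2 * π)) - T / (2 * π)))
      =O[atTop] Real.log := by
  obtain ⟨C, hC⟩ := abs_measureReal_Icc_sub_theta_le hb hμ
  have hC0 : 0 ≤ C := by
    have h00 := (hC 0 le_rfl).1
    simp only [riemannSiegelTheta_zero, zero_div, sub_zero, add_zero, Real.log_one, mul_one] at h00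
    exact (abs_nonneg _).trans h00
  -- (1) the counting law: `μ[0,T] − θ(T)/π = O(log T)`
  have h1 : (fun T : ℝ ↦ μ.real (Icc 0 T) - riemannSiegelTheta T / π) =O[atTop] Real.log := by
    refine IsBigO.of_bound (3 * C) ?_
    filter_upwards [eventually_ge_atTop (3 : ℝ)] with T hT
    obtain ⟨hl1, hl2⟩ := log_one_add_le_two_mul_log hT
    have h := (hC T (by linarith)).1
    rw [Real.norm_eq_abs, Real.norm_eq_abs, abs_of_pos (by linarith : 0 < Real.log T)]
    calc |μ.real (Icc 0 T) - riemannSiegelTheta T / π| ≤ C * (1 + Real.log (1 + T)) := h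
      _ ≤ C * (Real.log T + 2 * Real.log T) := by gcongr
      _ = 3 * C * Real.log T := by ring
  -- (2) Stirling: `θ(T)/π − main(T) = (θ(T) − S(T))/π − 1/8 = O(1/T) + O(1) = O(log T)`
  have hinv : (fun T : ℝ ↦ T⁻¹) =O[atTop] Real.log := by
    refine IsBigO.of_bound 1 ?_
    filter_upwards [eventually_ge_atTop (3 : ℝ)] with T hT
    obtain ⟨-, hl2⟩ := log_one_add_le_two_mul_log hT
    rw [Real.norm_eq_abs, Real.norm_eq_abs, abs_of_pos (by positivity),
      abs_of_pos (by linarith : 0 < Real.log T), one_mul]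
    exact (inv_le_one_of_one_le₀ (by linarith)).trans hl2
  have hconst : (fun _ : ℝ ↦ (1 / 8 : ℝ)) =O[atTop] Real.log := by
    refine IsBigO.of_bound 1 ?_
    filter_upwards [eventually_ge_atTop (3 : ℝ)] with T hT
    obtain ⟨-, hl2⟩ := log_one_add_le_two_mul_log hT
    rw [Real.norm_eq_abs, Real.norm_eq_abs, abs_of_pos (by linarith : 0 < Real.log T), one_mul]
    rw [abs_of_pos (by norm_num)]
    linarith
  have h2 : (fun T : ℝ ↦ riemannSiegelTheta T / π -
      (T / (2 * π) * Real.log (T / (2 * π)) - T / (2 * π))) =O[atTop] Real.log := by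
    have hθ := isBigO_riemannSiegelTheta_sub_stirling_holds
    have h3 := ((hθ.trans hinv).const_mul_left (1 / π)).sub hconst
    refine h3.congr' (Eventually.of_forall fun T ↦ ?_) EventuallyEq.rfl
    field_simp
    ring
  refine (h1.add h2).congr' (Eventually.of_forall fun T ↦ ?_) EventuallyEq.rfl
  ring

/-! ## Local density -/

/-- The Riemann–Siegel theta function grows by at most `(5 + log(2 + T))/2` on `[T, T + 1]`, `T ≥ 0`
(`θ' (u) = Re ψ(¼ + iu/2)/2 − (log π)/2` and `|Re ψ(¼ + iu/2)| ≤ 5 + log(1 + |u|)`). -/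
theorem theta_sub_theta_le {T : ℝ} (hT : 0 ≤ T) :
    riemannSiegelTheta (T + 1) - riemannSiegelTheta T ≤ (5 + Real.log (2 + T)) / 2 := by
  have hcont : Continuous riemannSiegelThetaDeriv := by
    have h : riemannSiegelThetaDeriv = fun u ↦ reDigammaQuarter u / 2 - Real.log π / 2 := by
      funext u; rfl
    rw [h]
    exact (continuous_reDigammaQuarter.div_const _).sub continuous_const
  have hii : ∀ a c : ℝ, IntervalIntegrable riemannSiegelThetaDeriv volume a c := fun a c ↦
    hcont.intervalIntegrable _ _
  have hsub : riemannSiegelTheta (T + 1) - riemannSiegelTheta T =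
      ∫ u in T..(T + 1), riemannSiegelThetaDeriv u := by
    unfold riemannSiegelTheta
    exact intervalIntegral.integral_interval_sub_left (hii _ _) (hii _ _)
  rw [hsub]
  have hbound : ∀ u ∈ Icc T (T + 1), riemannSiegelThetaDeriv u ≤ (5 + Real.log (2 + T)) / 2 := by
    intro u hu
    have h1 := SpectralTraceWindowTraceArch.stub_countingLaw_abs_reDigammaQuarter_le u
    have h2 : Real.log (1 + |u|) ≤ Real.log (2 + T) := by
      rw [abs_of_nonneg (by linarith [hu.1])]
      exact Real.log_le_log (by linarith [hu.1]) (by linarith [hu.2])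
    have h3 : 0 ≤ Real.log π := Real.log_nonneg (by linarith [Real.pi_gt_three])
    have h4 : reDigammaQuarter u ≤ 5 + Real.log (2 + T) := by linarith [le_abs_self (reDigammaQuarter u)]
    show reDigammaQuarter u / 2 - Real.log π / 2 ≤ _
    linarith
  calc ∫ u in T..(T + 1), riemannSiegelThetaDeriv u
      ≤ ∫ _ in T..(T + 1), (5 + Real.log (2 + T)) / 2 :=
        intervalIntegral.integral_mono_on (by linarith) (hii _ _) (by simp) hbound
    _ = (5 + Real.log (2 + T)) / 2 := by simp

/-- **Local density law: `μ(T, T + 1] ≤ C (1 + log(2 + T))`** for `T ≥ 0` and every measure representing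
Weil's form on a window (the counting law at `T` and `T + 1`, and `theta_sub_theta_le`). -/
theorem measureReal_Ioc_unit_le (hb : 0 < b)
    (hμ : ∀ g : ℝ → ℂ, IsWeilTest g → tsupport g ⊆ Icc (-b) b →
      Integrable (fun t : ℝ ↦ ‖weilMellin g (1 / 2 + t * I)‖ ^ 2) μ ∧
        weilQuadratic g = ((∫ t, ‖weilMellin g (1 / 2 + t * I)‖ ^ 2 ∂μ : ℝ) : ℂ)) :
    ∃ C : ℝ, ∀ T : ℝ, 0 ≤ T → μ.real (Ioc T (T + 1)) ≤ C * (1 + Real.log (2 + T)) := by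
  obtain ⟨C, hC⟩ := measureReal_Icc_short_le hb hμ
  refine ⟨C + 3, fun T hT ↦ ?_⟩
  have h := hC T hT
  have hθ := theta_sub_theta_le hT
  have hπ : (riemannSiegelTheta (T + 1) - riemannSiegelTheta T) / π ≤ (5 + Real.log (2 + T)) / 2 / π :=
    div_le_div_of_nonneg_right hθ Real.pi_pos.le
  have hlog : 0 ≤ Real.log (2 + T) := Real.log_nonneg (by linarith)
  have h3 : (5 + Real.log (2 + T)) / 2 / π ≤ 3 * (1 + Real.log (2 + T)) := by
    rw [div_div, div_le_iff₀ (by positivity)]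
    nlinarith [Real.pi_gt_three]
  linarith

end Summit.RiemannHypothesis.RiemannHypothesis.Theorems.WeilBochnerMeasure

end
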